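import Mathlib.Algebra.Polynomial.Laurent
import Mathlib.Algebra.CharP.Algebra
import Mathlib.Algebra.CharP.Lemmas
import HarnessLib

/-!
# Laurent polynomial rings inherit the (exponential) characteristic

Mathlib records `Polynomial.instCharP : CharP R[X] p` but no corresponding fact for the Laurent polynomial
ring `R[T;T⁻¹] = AddMonoidAlgebra R ℤ`. This file supplies the two missing INSTANCES, in the shape of Mathlib's
`Polynomial.instCharP` (base ring and `p` as parameters, premise `[CharP R p]` resp. `[ExpChar R p]`): the
constant map `C : R →+* R[T;T⁻¹]` is injective (private helper), hence `R[T;T⁻¹]` has the same characteristic /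
exponential characteristic as `R` (`charP_of_injective_ringHom`, `expChar_of_injective_ringHom`). They do not
override or duplicate any Mathlib instance (Mathlib v4.32.0 has none for `LaurentPolynomial` / `AddMonoidAlgebra`).

Use in this tree: the statements-first typing of Hironaka 2017 §§11–13 (cell `res-hironaka`) models the graded
algebra `Bl(Z) = ⊕_{j∈ℤ} O` as `O[T;T⁻¹]` and needs the Frobenius `iterateFrobenius O[T;T⁻¹] p k`
(`Literature.AlgebraicGeometry.Hironaka2017.S11CoordFree.tau` with `B := O[T;T⁻¹]`, Rem. 11.2's `ρ^k(Bl(Z))`).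
Standard facts; no source beyond Mathlib's API is claimed.
-/

namespace Literature.Algebra.Polynomial

open LaurentPolynomial

/-- The constant embedding `C : R →+* R[T;T⁻¹]` into the Laurent polynomial ring is injective
(it factors as `Polynomial.C` followed by the injective `Polynomial.toLaurent`). [folklore] -/
private theorem laurentPolynomial_C_injective (R : Type*) [Semiring R] :
    Function.Injective (C : R →+* R[T;T⁻¹]) := fun a b h =>
  Polynomial.C_inj.mp (Polynomial.toLaurent_injective (by simpa only [Polynomial.toLaurent_C] using h))

/-- A Laurent polynomial ring `R[T;T⁻¹]` over a semiring of characteristic `p` has characteristic `p`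
(the Laurent analogue of Mathlib's `Polynomial.instCharP`). [folklore] -/
instance instCharPLaurentPolynomial (R : Type*) [Semiring R] (p : ℕ) [CharP R p] : CharP R[T;T⁻¹] p :=
  charP_of_injective_ringHom (laurentPolynomial_C_injective R) p

/-- A Laurent polynomial ring `R[T;T⁻¹]` over a semiring of exponential characteristic `p` has exponential
characteristic `p` (so Mathlib's `frobenius` / `iterateFrobenius` are available on it). [folklore] -/
instance instExpCharLaurentPolynomial (R : Type*) [Semiring R] (p : ℕ) [ExpChar R p] : ExpChar R[T;T⁻¹] p :=
  expChar_of_injective_ringHom (laurentPolynomial_C_injective R) p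

end Literature.Algebra.Polynomial
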